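import Summits.CriticalPhenomena.PercolationContinuityZ3.Theorems.PercNearOneGluingNoHeavyLowerTailFrontierDecRowsUnmarkedEdgeKey
import Literature.Probability.Percolation.TwoSetExchange
import Literature.Probability.Percolation.ConditionalPositiveAssociationProofs
import Literature.Probability.LatticeModels.SahiThirdOrderCorrelation
import HarnessLib
import HarnessLib.Audit.Tags

/-!
# Conjecture G⁺ — the CLUSTER-MONOTONE third-order BHK inequality, as a named statement

Definitions file (prover prim-ineq-prove-3 gen 10 cycle 1; reviewed; `--supports stmt-CriticalPhenomena-4575`).  No sorries, no
`native_decide`, no named facts assumed.  This file NAMES a conjecture of this work (it is NOT a published result, hence not a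
`Literature` fact) so that (a) the reductions of `…FrontierDecRowsTypedBHK3` (`frontier_{36,44,15}_of_clusterBHK3`, p243169) and
`…FrontierDecRowsLiteralDropping` (rows 12/27/30 ⇐ 44, p239574) can be stated against ONE name, and (b) a promotion request can point at a
declaration (lead prim-nh-lead-4575 g58, `FROM-prim-nh-lead-4575-g58-ANSWER-CONJECTURE-G.md` §3).

STATEMENT (`ClusterBHK3Pos`).  For every finite weighted graph (`prodBernoulli w` on `Fin n`), all terminal sets `S, T`, every event `A`
that is an increasing function of the open edge cluster `C_S = ⋃_{s ∈ S} C_s` ALONE and every event `B` that is an increasing function of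
`C_T` alone:  `0 ≤ E₃({S ↮ T}, Aᶜ, Bᶜ)` (tree `sahiE3`).  Degenerate cases are harmless: `S ∩ T ≠ ∅ ⇒ D = ∅ ⇒ E₃ = 0`; `T = ∅ ⇒ B ∈ {∅, univ}`
and `E₃ ∈ {0, Cov(1_D, 1_{Aᶜ})}`, which is `≥ 0` by Harris.

WHY THIS CLASS (erratum to p240166).  BHK's types `(±)` — closed under (enlarging `C_S`, shrinking `C_T`) — admit DECREASING events
(`{t ↮ v}`, `{S ↮ T}` itself) and the so-typed hypothesis is refutable (`…FrontierDecRowsTypedBHK3HypothesisFalse`, lead g58: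
`E₃(Xᶜ, X, X) = −x(1−x)²`).  For UP-SETS the two typings coincide (`clusterMono_iff_isUpperSet_and_typePlus` below), so `ClusterBHK3Pos` is
exactly the lead's "G⁺" / `TypedBHK3Pos` with `IsUpperSet` added.

EVIDENCE (exact laws, no sampling; 0 violations throughout): connection-literal class — 59 722 typed four-terminal cases × (100 + 16·70 +
16·25) laws `n ≤ 8` (kit j110343, j110614: 9.1·10⁷ (case, law) checks), 124 190 five-terminal cases × 60 laws, 10 834 × 389 structured laws;
lead g58 independently 26 211 cases (24 exact zeros, all tree-like); GENERAL cluster-increasing class (random thresholds of weighted edge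
counts of `C_S`/`C_T`, required edge subsets, vertex-hit counts and their ∧/∨-combinations) — 1.2·10⁶ cases on 6 000 laws `n ≤ 6`
(lab/g_probe_gen.py).  Minimum `0` is attained (e.g. the two-edge star `s – v – t`, `A = {s~v}`, `B = {t~v}`: `E₃ ≡ 0`).
EQUIVALENT FORMS (memo FINDING-HYBRID-gen10.md §10): `−E₃(D, A, B) ≤ |Cov(1_D,1_A)| + |Cov(1_D,1_B)|`;
`Cov(1_A,1_B) + 2Δ′ ≤ δ_A μ(Bᶜ) + δ_B μ(Aᶜ) + 2δ_Aδ_B` with the Harris drops `δ_A = μ(A) − μ(A | D) ≥ 0` and the conditional BHK deficit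
`Δ′ = μ(A|D)μ(B|D) − μ(A∩B|D) ≥ 0` (BHK 2006 Thm 2.1 = tree `setTwoClusterExchange`).
CONSEQUENCES IF TRUE: open four-point dec rows 36 (PATH), 44, 15 (`…TypedBHK3`), hence 12, 27, 30 (`…LiteralDropping`); the only open
dec orbit not covered is 37 `(D[ab|c], D[ac|y], D[ay|b])`.

* `ClusterBHK3Pos` — the conjecture as a `Prop`.
* `isUpperSet_of_clusterMono` — cluster-monotone events are up-sets.
* `clusterMono_iff_isUpperSet_and_typePlus` — for `(C_S, C_T)`: cluster-monotone in `C_S` ⟺ (up-set ∧ BHK type `(+)`).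
* `ClusterBHK3Key` — the one-edge (KEY) form G-KEY of the conjecture (appended gen 10 cycle 1); `ClusterBHK3Key → ClusterBHK3Pos` is
  `…FrontierDecRowsClusterBHK3Key`.
-/

namespace Summit.CriticalPhenomena.PercolationContinuityZ3.Theorems.FrontierDecRows

open MeasureTheory
open Literature.Probability.Percolation Literature.Probability.LatticeModels
open Literature.Probability.Percolation.TwoSetExchange

/-- **Conjecture G⁺ (cluster-monotone third-order BHK inequality)** [conjecture, this work — prim-ineq-prove-3 gen 10; NOT a published
result; evidence: 0 violations in > 9·10⁷ exact (case, law) checks, see the module docstring].  For all `n`, all edge weights `w`, all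
terminal sets `S, T ⊆ Fin n`, every event `A` closed under enlarging `C_S = ⋃_{s∈S} C_s` (an increasing function of the open edge cluster
of `S` alone) and every event `B` closed under enlarging `C_T`:  `0 ≤ E₃({S ↮ T}, Aᶜ, Bᶜ)` under `prodBernoulli w`. -/
@[conjecture]
def ClusterBHK3Pos : Prop :=
  ∀ (n : ℕ) (w : Sym2 (Fin n) → unitInterval) (S T : Set (Fin n)) (A B : Set (BondConfig (Fin n))),
    (∀ ⦃ω ω' : BondConfig (Fin n)⦄,
        (⋃ s ∈ S, openEdgeCluster ω s) ⊆ (⋃ s ∈ S, openEdgeCluster ω' s) → ω ∈ A → ω' ∈ A) →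
    (∀ ⦃ω ω' : BondConfig (Fin n)⦄,
        (⋃ t ∈ T, openEdgeCluster ω t) ⊆ (⋃ t ∈ T, openEdgeCluster ω' t) → ω ∈ B → ω' ∈ B) →
    0 ≤ sahiE3 (prodBernoulli w) {ω : BondConfig (Fin n) | ∀ s ∈ S, ∀ t ∈ T, ¬ (openGraph ω).Reachable s t} Aᶜ Bᶜ

variable {V : Type*}

/-- The union of clusters `C_S(ω) = ⋃_{s ∈ S} C_s(ω)` is increasing in the configuration. [cite: VandenbergHaggstromKahn2005, §1 p. 3] -/
theorem biUnion_openEdgeCluster_mono (S : Set V) {ω ω' : BondConfig V} (h : ω ⊆ ω') :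
    (⋃ s ∈ S, openEdgeCluster ω s) ⊆ (⋃ s ∈ S, openEdgeCluster ω' s) :=
  Set.biUnion_mono (fun _ hs => hs) fun s _ => BHK2006.openEdgeCluster_mono h s

/-- **Cluster-monotone events are up-sets**: if `A` is closed under enlarging `C_S`, then `A` is increasing in the configuration.
[folklore; cite: VandenbergHaggstromKahn2005, §1 p. 3] -/
theorem isUpperSet_of_clusterMono (S : Set V) {A : Set (BondConfig V)}
    (hA : ∀ ⦃ω ω' : BondConfig V⦄, (⋃ s ∈ S, openEdgeCluster ω s) ⊆ (⋃ s ∈ S, openEdgeCluster ω' s) → ω ∈ A → ω' ∈ A) :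
    IsUpperSet A :=
  fun _ _ hle hω => hA (biUnion_openEdgeCluster_mono S hle) hω

/-- `C_S(ω)`, viewed as a configuration, lies below `ω`. [folklore] -/
theorem biUnion_openEdgeCluster_subset (S : Set V) (ω : BondConfig V) :
    (⋃ s ∈ S, openEdgeCluster ω s) ⊆ ω :=
  Set.iUnion₂_subset fun s _ => openEdgeCluster_subset ω s

/-- `C_S` of the configuration `C_S(ω)` is `C_S(ω)` again (upward direction: `C_S(ω) ⊆ C_S(C_S(ω))`). [folklore] -/
theorem biUnion_openEdgeCluster_subset_self (S : Set V) (ω : BondConfig V) :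
    (⋃ s ∈ S, openEdgeCluster ω s) ⊆ (⋃ s ∈ S, openEdgeCluster (⋃ s ∈ S, openEdgeCluster ω s) s) :=
  Set.iUnion₂_mono fun _ hs => openEdgeCluster_subset_of_subset fun _ he => Set.mem_biUnion hs he

/-- **The two typings agree on up-sets.**  An event is an increasing function of `C_S` alone iff it is an up-set of BHK type `(+)` for
`(C_S, C_T)` (closed under enlarging `C_S` and shrinking `C_T`), for ANY `T`.  (`⇐`: pass through the configuration `C_S(ω)` itself, which
has the same `C_S`, a smaller `C_T`, and lies below `ω'`.)  This identifies `ClusterBHK3Pos` with the lead's `IsUpperSet`-corrected typed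
form "G⁺". [this work] -/
theorem clusterMono_iff_isUpperSet_and_typePlus (S T : Set V) (A : Set (BondConfig V)) :
    (∀ ⦃ω ω' : BondConfig V⦄, (⋃ s ∈ S, openEdgeCluster ω s) ⊆ (⋃ s ∈ S, openEdgeCluster ω' s) → ω ∈ A → ω' ∈ A) ↔
    (IsUpperSet A ∧ ∀ ⦃ω ω' : BondConfig V⦄, (⋃ s ∈ S, openEdgeCluster ω s) ⊆ (⋃ s ∈ S, openEdgeCluster ω' s) →
        (⋃ t ∈ T, openEdgeCluster ω' t) ⊆ (⋃ t ∈ T, openEdgeCluster ω t) → ω ∈ A → ω' ∈ A) := by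
  refine ⟨fun hA => ⟨isUpperSet_of_clusterMono S hA, fun ω ω' hs _ hω => hA hs hω⟩, fun ⟨hup, htyp⟩ ω ω' hs hω => ?_⟩
  -- pass through η := C_S(ω)
  have hη : (⋃ s ∈ S, openEdgeCluster ω s) ∈ A :=
    htyp (biUnion_openEdgeCluster_subset_self S ω)
      (biUnion_openEdgeCluster_mono T (biUnion_openEdgeCluster_subset S ω)) hω
  exact hup (hs.trans (biUnion_openEdgeCluster_subset S ω')) hη

/-! ### The one-edge (KEY) form G-KEY (gen 10 cycle 1)

FINDING (memo §14; INEQ-CLAIMS row G-KEY).  On the typed class, Sahi's `E₃` appears to be DELETION-MONOTONE to first order: for every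
weight `w` and every pair `e`, prim-bnk-1's edge KEY form `TerminalEdgeInduction.key μ_{w[e↦0]} μ_{w[e↦1]} = 3B₁ − 2B₀ = T(0) + T′(0)`
(`…FrontierDecRowsUnmarkedEdgeKey`) of the triple `({S ↮ T}, Aᶜ, Bᶜ)` is `≥ 0` — 362 716 exact (case, edge) forms on random weighted
graphs `n ≤ 6` (incl. 81 502 with skewed weights {.05,.2,.5,.8,.95}), 0 violations, `K = 0` attained; the same property (`DELMONO-E3`) is
FALSE one literal outside the typed class (prim-ineq-prove-2 gen 5, theta-graph witness).  By the schema
`EdgeInduction.sahiE3_nonneg_of_edgeKey` (…FrontierDecRowsEdgeKeyInduction) `ClusterBHK3Key → ClusterBHK3Pos`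
(`…FrontierDecRowsClusterBHK3Key`).  The induction hypotheses (`E₃ ≥ 0` at both endpoint laws) are kept in the statement, as the schema
allows them (numerically `K ≥ 0` holds even without them). -/

/-- **Conjecture G-KEY (one-edge form of G⁺)** [conjecture, this work — prim-ineq-prove-3 gen 10 cycle 1; NOT a published result;
evidence: 0 violations in 362 716 exact (case, edge) forms, see the section docstring].  For all `n`, terminal sets `S, T`, cluster-monotone
`A` (w.r.t. `C_S`) and `B` (w.r.t. `C_T`), every weight function `w` and every pair `e`: if `E₃({S ↮ T}, Aᶜ, Bᶜ) ≥ 0` under `w[e↦0]` and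
under `w[e↦1]`, then the edge KEY form `key μ_{w[e↦0]} μ_{w[e↦1]} {S ↮ T} Aᶜ Bᶜ` is nonnegative. -/
@[conjecture]
def ClusterBHK3Key : Prop :=
  ∀ (n : ℕ) (S T : Set (Fin n)) (A B : Set (BondConfig (Fin n))),
    (∀ ⦃ω ω' : BondConfig (Fin n)⦄,
        (⋃ s ∈ S, openEdgeCluster ω s) ⊆ (⋃ s ∈ S, openEdgeCluster ω' s) → ω ∈ A → ω' ∈ A) →
    (∀ ⦃ω ω' : BondConfig (Fin n)⦄,
        (⋃ t ∈ T, openEdgeCluster ω t) ⊆ (⋃ t ∈ T, openEdgeCluster ω' t) → ω ∈ B → ω' ∈ B) →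
    ∀ (w : Sym2 (Fin n) → unitInterval) (e : Sym2 (Fin n)),
      0 ≤ sahiE3 (prodBernoulli (Function.update w e 0))
            {ω : BondConfig (Fin n) | ∀ s ∈ S, ∀ t ∈ T, ¬ (openGraph ω).Reachable s t} Aᶜ Bᶜ →
      0 ≤ sahiE3 (prodBernoulli (Function.update w e 1))
            {ω : BondConfig (Fin n) | ∀ s ∈ S, ∀ t ∈ T, ¬ (openGraph ω).Reachable s t} Aᶜ Bᶜ →
      0 ≤ TerminalEdgeInduction.key (prodBernoulli (Function.update w e 0)) (prodBernoulli (Function.update w e 1))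
            {ω : BondConfig (Fin n) | ∀ s ∈ S, ∀ t ∈ T, ¬ (openGraph ω).Reachable s t} Aᶜ Bᶜ

end Summit.CriticalPhenomena.PercolationContinuityZ3.Theorems.FrontierDecRows
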